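import Literature.Barriers.QuantumAdvantage.SupremacyTheoremsNonRelativizing
import Literature.Barriers.QuantumAdvantage.AaronsonChenOracle
import Literature.Computability.QuantumComplexity.CountingSimulationRel
import Literature.Computability.Complexity.OracleBPP
import Literature.Computability.Complexity.OracleEmpty
import Literature.Computability.Complexity.PRelHierarchy
import Literature.Computability.Complexity.UPDiagonalOracle
import Literature.Computability.QuantumComplexity.FortnowRogersBrain
import Literature.Computability.QuantumComplexity.BPPRelSubsetBQPRel
import HarnessLib

/-!
# `SupremacyTheoremsNonRelativizing`: the decomposition into leaf facts (proof architecture of Fortnow–Rogers 1999, Cor. 3.7 / Thm. 4.2 and Aaronson–Chen 2017, Cor. 5.2)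

Sibling proof file (D-0014 append protocol) of the barrier entry
`SupremacyTheoremsNonRelativizing.lean` (D-0021), whose fact
`SupremacyTheoremsNonRelativizing := fortnowRogers1999_cor37 ∧ fortnowRogers1999_thm42 ∧ aaronsonChen2017_cor52`
conjoins three printed oracle constructions (held arXiv copies, arXiv numbering):

* L. Fortnow, J. Rogers, *Complexity limitations on quantum computation*, JCSS 59 (1999)
  [FortnowRogers1999JCSS], Cor. 3.7 (p. 5): a relativized world with `P = BQP` and an infinite
  polynomial-time hierarchy; Thm. 4.2 (p. 7): an oracle `C` with
  `P^C = BPP^C = BQP^C ≠ UP^C ∩ coUP^C` (whence Thm. 4.1: one-way functions and `P^C = BQP^C`);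
* S. Aaronson, L. Chen, *Complexity-theoretic foundations of quantum supremacy experiments*,
  CCC 2017 [AaronsonChen2017], Cor. 5.2 (p. 21): an oracle `O' = TQBF ⊕ O` with
  `SampBPP^{O'} = SampBQP^{O'}` and `PH^{O'}` infinite.

Each conjunct is a theory-sized formalization and is decomposed in its own tree file; this file
records, BY PROOF, the whole dependency graph of the barrier fact down to the named leaf facts,
reusing those decompositions and adding the missing one (Thm. 4.2):

* Cor. 3.7 — `Literature/Computability/QuantumComplexity/CountingSimulationRel.lean`:
  `exists_oracle_PRel_eq_BQPRel_infinitePH_of_parts` from `PRel_ofLanguage_subset_BQPRel`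
  (`P^A ⊆ BQP^A`), `BQPRel_subset_AWPPRel` (Thm. 3.1 relativized) and the oracle-existence
  statement of the printed proof, `∃ A, P^A = AWPP^A ∧ PH^A infinite` (Thm. 3.6 joined with a
  generic oracle — the unnumbered glue step of the proof, an explicit hypothesis `h₃`, not a named
  fact; it is PROVED from its two published halves, Fenner–Fortnow–Kurtz–Li Thm. 6.18 (2)
  rerelativized and "`PH` is infinite relative to generic oracles", in `FortnowRogersOracle.lean`,
  which imports this file); its rev. 2 adds the leaf `BPPRel_ofLanguage_subset_BQPRel`
  (`BPP^A ⊆ BQP^A`, Bernstein–Vazirani Thm. 8.3 relativized) and derives `P^A ⊆ BQP^A` from it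
  (`PRel_ofLanguage_subset_BQPRel_of_BPPRel`). Here `fortnowRogers1999_cor37_of_parts` restates
  the assembly against the barrier's `def`, with `P^A ⊆ BQP^A` so derived and the tree fact
  `P^O ⊆ BPP^O` discharged (`PRel_subset_BPPRel_holds`).
* Thm. 4.2 — new here. The printed proof (p. 7) shows two things about `C = H ⊕ G` (`H`
  `PSPACE`-complete, `G` a `UP ∩ coUP`-generic): "First we show that `P^C ≠ UP^C ∩ coUP^C`" and
  "Next we show that `P^C = BQP^C`", i.e. `BQP^C ⊆ P^C` (by Thm. 4.3 = BBBV, proved in the tree as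
  `Literature.Computability.QuantumComplexity.fortnowRogers1999_thm43`, `HybridArgument.lean`); the
  equalities `P^C = BPP^C = BQP^C` are then the sandwich `P^C ⊆ BPP^C ⊆ BQP^C ⊆ P^C`. Accordingly:
  the named leaf `fortnowRogers1999_thm42_core` (`∃ C, BQP^C ⊆ P^C ∧ P^C ≠ UP^C ∩ coUP^C`, the two
  printed claims), the assembly `fortnowRogers1999_thm42_of_parts` from it and the shared leaf
  `BPPRel_ofLanguage_subset_BQPRel` ("and so `P = BPP = BQP`", p. 7), its converse
  `fortnowRogers1999_thm42.core` (so the core is not a weakening in disguise), and Thm. 4.1 AS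
  PRINTED, derived: `fortnowRogers1999_thm42.thm41`
  (one-way functions relative to `C` read as `P^C ≠ UP^C`, Grollmann–Selman, §2.5 p. 4), using
  `P^O ⊆ UP^O ∩ coUP^O` (`PRel_subset_UPRel`, `PRel_subset_coUPRel`) and the closure of `P^O`
  under complement (tree theorem `compl_mem_PRel`).
* Cor. 5.2 — `AaronsonChenOracle.lean`: `aaronsonChen2017_cor52_of_parts` from
  `aaronsonChen2017_thm51_sampBQP_subset` (§5.3), `SampPRel_subset_SampBQPRel` and
  `aaronsonChen2017_thm51_ph` (§5.4, via Rossman–Servedio–Tan).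

Main result: `SupremacyTheoremsNonRelativizing.of_parts` — the barrier fact from the SIX leaf
facts `BPPRel_ofLanguage_subset_BQPRel`, `BQPRel_subset_AWPPRel`, `fortnowRogers1999_thm42_core`,
`aaronsonChen2017_thm51_sampBQP_subset`, `SampPRel_subset_SampBQPRel`, `aaronsonChen2017_thm51_ph`
(none discharged at the time of writing) and the oracle-existence hypothesis `h₃` of Cor. 3.7
(`SupremacyTheoremsNonRelativizing_holds` is this theorem applied to the `_holds` of the leaves
and to the proof of `h₃` from the genericity facts of `FortnowRogersOracle.lean`, as assembled in
`SupremacyTheoremsNonRelativizingAssembly.lean`). Also: the barrier's no-go theorems with the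
hypothesis `PRel_subset_BPPRel` discharged (`SupremacyTheoremsNonRelativizing.summary_canonical'`,
`fortnowRogers1999_cor37.not_relativizes_collapse_template`) and the anchors `UPRel_empty'`,
`coUPRel_empty'`.

## Design notes

* Nothing of `CountingSimulationRel.lean` / `AaronsonChenOracle.lean` is restated (review of
  p14439): their leaves are imported and consumed as hypotheses.
* `P^A ⊆ BQP^A` is not an independent leaf: it follows from `BPP^A ⊆ BQP^A` and the discharged
  `P^O ⊆ BPP^O`, and Thm. 4.2 needs the `BPP` form anyway; so Cor. 3.7 and Thm. 4.2 share it.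
* `fortnowRogers1999_thm42_core` is typed at the language oracle `Oracle.ofLanguage C` like
  `fortnowRogers1999_thm42`; its level-2 decomposition (a `PSPACE`-complete `H` with
  `P^H`-computable acceptance probabilities of oracle circuits; existence of `UP ∩ coUP`-generics
  relative to `H` (Fortnow–Rogers 1994, Blum–Impagliazzo 1987); the diagonalization
  `L^G ∉ P^G`; categoricity; BBBV) is left to the tenure notes of `fortnowRogers1999_thm42`.
* Imports are proof-level (machine files `OracleBPP`, `OracleEmpty`, `PRelHierarchy` for the
  discharged `PRel_subset_BPPRel_holds`, `PRel_empty_holds`, `PRel_closed_boolUnpair_fst`,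
  `compl_mem_PRel`), which the statement file deliberately avoids.

## Sources

* [FortnowRogers1999JCSS] arXiv:cs/9811023, re-read via `lit read arxiv:cs/9811023 --pages 4,5,7,8`:
  §2.5 p. 4 (UP; one-way functions exist iff `P ≠ UP`, Grollmann–Selman), Thm. 3.1, Thm. 3.6,
  Cor. 3.7 (p. 5), Thm. 4.1, Thm. 4.2, Thm. 4.3 and the proof of Thm. 4.2 (pp. 7–8).
* [AaronsonChen2017] arXiv:1612.05903, re-read via `lit read arxiv:1612.05903 --pages 21,24`:
  Thm. 5.1, Cor. 5.2, Lemma 5.3 (p. 21), §5.4 (p. 24).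
* [BernsteinVazirani1997SICOMP] Thm. 8.3 (`BPP ⊆ BQP`, p. 1451), §8.3 (oracle QTMs), as cited in
  `CountingSimulationRel.lean` and `Literature/Barriers/QuantumAdvantage/Relativization.lean`.
-/

noncomputable section

namespace Literature.Barriers.QuantumAdvantage

open _root_.Computability Literature.Computability.Complexity Literature.Computability.Complexity.Classes
  Literature.Computability.Cryptography Literature.Computability.QuantumComplexity PneNP

/-! ### `P^O ⊆ UP^O ∩ coUP^O` -/

/-- `P^O ⊆ UP^O`: witness polynomial `0`, so the only admissible witness is the empty string,
and the verifier `{w | (boolUnpair w).1 ∈ L} ∈ P^O` (`PRel_closed_boolUnpair_fst`). [folklore] -/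
theorem PRel_subset_UPRel (O : Oracle) : PRel O ⊆ UPRel O := by
  intro L hL
  refine ⟨{w | (boolUnpair w).1 ∈ L}, PRel_closed_boolUnpair_fst O hL, 0, fun x => ?_, fun x => ?_⟩
  · constructor
    · intro hx
      refine ⟨[], by simp, ?_⟩
      change (boolUnpair (boolPair x [])).1 ∈ L
      rwa [boolUnpair_boolPair]
    · rintro ⟨y, -, hy⟩
      change (boolUnpair (boolPair x y)).1 ∈ L at hy
      rwa [boolUnpair_boolPair] at hy
  · intro y hy y' hy'
    have h1 : y.length ≤ 0 := by simpa using hy.1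
    have h2 : y'.length ≤ 0 := by simpa using hy'.1
    rw [List.eq_nil_of_length_eq_zero (Nat.le_zero.1 h1),
      List.eq_nil_of_length_eq_zero (Nat.le_zero.1 h2)]

/-- `P^O ⊆ coUP^O` (`P^O` is closed under complement, `compl_mem_PRel`). [folklore] -/
theorem PRel_subset_coUPRel (O : Oracle) : PRel O ⊆ coUPRel O :=
  fun _ hL => PRel_subset_UPRel O (compl_mem_PRel hL)

/-- `P^O ⊆ UP^O ∩ coUP^O`, so Fortnow–Rogers' `P^C ≠ UP^C ∩ coUP^C` is a proper containment.
[cite: FortnowRogers1999JCSS, Thm. 4.2 (arXiv numbering)] -/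
theorem PRel_subset_UPRel_inter_coUPRel (O : Oracle) : PRel O ⊆ UPRel O ∩ coUPRel O :=
  Set.subset_inter (PRel_subset_UPRel O) (PRel_subset_coUPRel O)

/-- If `UP^O = P^O` then `UP^O ∩ coUP^O = P^O` (as `P^O` is closed under complement).
[folklore] -/
theorem UPRel_inter_coUPRel_eq_of_eq {O : Oracle} (h : UPRel O = PRel O) :
    UPRel O ∩ coUPRel O = PRel O := by
  ext L
  simp only [coUPRel, h, Set.mem_inter_iff]
  exact ⟨fun h' => h'.1, fun hL => ⟨hL, show Lᶜ ∈ PRel O from compl_mem_PRel hL⟩⟩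

/-! ### Fortnow–Rogers Thm. 4.2: the core oracle fact and the assembly -/

/-- **Fortnow–Rogers 1999, Thm. 4.2, the two claims of the printed proof** (p. 7): there is an
oracle language `C` — in print `C = H ⊕ G`, `H` `PSPACE`-complete, `G` a `UP ∩ coUP`-generic
oracle — such that `BQP^C ⊆ P^C` ("Next we show that `P^C = BQP^C`": a deterministic
polynomial-time `N` decides, relative to `C`, whether the `BQP^C` machine `M` accepts, using
Thm. 4.3 (BBBV, the tree's `fortnowRogers1999_thm43`) and its access to `H`) and
`P^C ≠ UP^C ∩ coUP^C` ("First we show": `L^G = {0ⁿ | ∃ x, |x| = n - 1 ∧ x0 ∈ G} ∈ UP^G ∩ coUP^G`,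
`L^C ∉ P^C` by diagonalization and genericity). Together with `P^C ⊆ BPP^C ⊆ BQP^C` this is
exactly Thm. 4.2 (`fortnowRogers1999_thm42_of_parts`, converse `fortnowRogers1999_thm42.core`).
Models as in `fortnowRogers1999_thm42` (`PRel`/`UPRel` at `Oracle.ofLanguage C`, `BQPRel C`).
[cite: FortnowRogers1999JCSS, Thm. 4.2 and its proof, pp. 7–8 (arXiv numbering)] -/
def fortnowRogers1999_thm42_core : Prop :=
  ∃ C : Language Bool, BQPRel C ⊆ PRel (Oracle.ofLanguage C) ∧
    PRel (Oracle.ofLanguage C) ≠ UPRel (Oracle.ofLanguage C) ∩ coUPRel (Oracle.ofLanguage C)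

/-- **Thm. 4.2 from its parts**: `P^C ⊆ BPP^C ⊆ BQP^C ⊆ P^C` at the oracle of
`fortnowRogers1999_thm42_core` gives `P^C = BPP^C = BQP^C ≠ UP^C ∩ coUP^C` ("and so
`P = BPP = BQP`"), using the leaf `BPP^A ⊆ BQP^A` and the discharged `P^O ⊆ BPP^O`.
[cite: FortnowRogers1999JCSS, Thm. 4.2 and its proof, p. 7 (arXiv numbering)] -/
theorem fortnowRogers1999_thm42_of_parts (h₁ : fortnowRogers1999_thm42_core)
    (h₂ : BPPRel_ofLanguage_subset_BQPRel) : fortnowRogers1999_thm42 := by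
  obtain ⟨C, hBQP, hUP⟩ := h₁
  have hPB : PRel (Oracle.ofLanguage C) ⊆ BPPRel (Oracle.ofLanguage C) := PRel_subset_BPPRel_holds _
  exact ⟨C, Set.Subset.antisymm hPB ((h₂ C).trans hBQP), Set.Subset.antisymm (h₂ C) (hBQP.trans hPB),
    hUP⟩

/-- Conversely Thm. 4.2 contains the core fact (so the leaf is equivalent to the printed
theorem given the sandwich, not a weakening). [cite: FortnowRogers1999JCSS, Thm. 4.2 (arXiv numbering)] -/
theorem fortnowRogers1999_thm42.core (h : fortnowRogers1999_thm42) : fortnowRogers1999_thm42_core := by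
  obtain ⟨C, hPB, hBQ, hUP⟩ := h
  exact ⟨C, fun L hL => by rwa [← hBQ, ← hPB] at hL, hUP⟩

/-- **Fortnow–Rogers 1999, Thm. 4.1, as printed and derived from Thm. 4.2**: "There is an oracle
`C` relative to which one-way functions exist and `P^C = BQP^C`", with "one-way functions exist"
in the paper's worst-case sense, equivalent to `P ≠ UP` (Grollmann–Selman, §2.5), relativized:
`P^C ≠ UP^C`. From Thm. 4.2: if `P^C = UP^C` then `UP^C ∩ coUP^C = P^C`
(`UPRel_inter_coUPRel_eq_of_eq`), contradicting `P^C ≠ UP^C ∩ coUP^C`.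
[cite: FortnowRogers1999JCSS, Thm. 4.1 (p. 7) and §2.5 (p. 4) (arXiv numbering)] -/
theorem fortnowRogers1999_thm42.thm41 (h : fortnowRogers1999_thm42) :
    ∃ C : Language Bool, PRel (Oracle.ofLanguage C) ≠ UPRel (Oracle.ofLanguage C) ∧
      PRel (Oracle.ofLanguage C) = BQPRel C := by
  obtain ⟨C, hPB, hBQ, hUP⟩ := h
  exact ⟨C, fun hPU => hUP (UPRel_inter_coUPRel_eq_of_eq hPU.symm).symm, hPB.trans hBQ⟩

/-- The oracle of Thm. 4.2 witnesses, once more, the collapsing half of the plain relativization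
barrier (`BQP^C ⊆ BPP^C`; compare the tree fact
`Literature.Computability.QuantumComplexity.exists_oracle_BQPRel_subset_BPPRel`). [cite: FortnowRogers1999JCSS, Thm. 4.2 (arXiv numbering)] -/
theorem fortnowRogers1999_thm42.exists_oracle_BQPRel_subset_BPPRel (h : fortnowRogers1999_thm42) :
    exists_oracle_BQPRel_subset_BPPRel := by
  obtain ⟨C, -, hBQ, -⟩ := h
  exact ⟨C, hBQ ▸ subset_rfl⟩

/-! ### Fortnow–Rogers Cor. 3.7 against the barrier's `def` -/

/-- **Cor. 3.7 from its parts** (the tree's `exists_oracle_PRel_eq_BQPRel_infinitePH_of_parts`,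
whose conclusion is the definiens of `fortnowRogers1999_cor37`), with `P^A ⊆ BQP^A` derived from
the leaf `BPP^A ⊆ BQP^A`; `h₃` is the oracle-existence statement of the printed proof — an oracle
`A` (in print `H ⊕ G`, `H` `PSPACE`-complete, `G` generic) with `P^A = AWPP^A` and `PH^A` infinite —
proved from the genericity facts in `FortnowRogersOracle.lean`
(`exists_oracle_PRel_eq_AWPPRel_infinitePH_of_generic`). [cite: FortnowRogers1999JCSS, Cor. 3.7 and its proof, §3 p. 5 (arXiv numbering)] -/
theorem fortnowRogers1999_cor37_of_parts (h₁ : BPPRel_ofLanguage_subset_BQPRel)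
    (h₂ : BQPRel_subset_AWPPRel)
    (h₃ : ∃ A : Language Bool, PRel (Oracle.ofLanguage A) = AWPPRel (Oracle.ofLanguage A) ∧
      IsInfinitePHRel (Oracle.ofLanguage A)) :
    fortnowRogers1999_cor37 :=
  exists_oracle_PRel_eq_BQPRel_infinitePH_of_parts
    (PRel_ofLanguage_subset_BQPRel_of_BPPRel h₁ PRel_subset_BPPRel_holds) h₂ h₃

/-! ### The barrier fact from the leaves -/

/-- **`SupremacyTheoremsNonRelativizing` from its leaf facts**: Fortnow–Rogers Cor. 3.7 from
`BPP^A ⊆ BQP^A`, `BQP^A ⊆ AWPP^A` and the oracle-existence statement `h₃` (`P^A = AWPP^A` with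
`PH^A` infinite, the generic-oracle step of the printed proof); Thm. 4.2 from its core oracle and
`BPP^A ⊆ BQP^A`; Aaronson–Chen Cor. 5.2 from the two halves of Thm. 5.1 (the a.s. inclusion of
§5.3, the trivial inclusion `SampBPP^A ⊆ SampBQP^A`, the a.s. infinite hierarchy of §5.4).
`SupremacyTheoremsNonRelativizing_holds` is this theorem fed with the discharges of the six leaf
facts and the proof of `h₃` (`FortnowRogersOracle.lean`).
[cite: FortnowRogers1999JCSS, Cor. 3.7 and Thm. 4.2 (arXiv numbering)] [cite: AaronsonChen2017, Cor. 5.2 (p. 21)] -/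
theorem SupremacyTheoremsNonRelativizing.of_parts (h₁ : BPPRel_ofLanguage_subset_BQPRel)
    (h₂ : BQPRel_subset_AWPPRel)
    (h₃ : ∃ A : Language Bool, PRel (Oracle.ofLanguage A) = AWPPRel (Oracle.ofLanguage A) ∧
      IsInfinitePHRel (Oracle.ofLanguage A))
    (h₄ : fortnowRogers1999_thm42_core) (h₅ : aaronsonChen2017_thm51_sampBQP_subset)
    (h₆ : SampPRel_subset_SampBQPRel) (h₇ : aaronsonChen2017_thm51_ph) :
    SupremacyTheoremsNonRelativizing :=
  ⟨fortnowRogers1999_cor37_of_parts h₁ h₂ h₃, fortnowRogers1999_thm42_of_parts h₄ h₁,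
    aaronsonChen2017_cor52_of_parts h₅ h₆ h₇⟩

/-- The same with the two halves of Aaronson–Chen's Thm. 5.1 taken whole
(`aaronsonChen2017_thm51_samp`, `aaronsonChen2017_thm51_ph`). [cite: AaronsonChen2017, Thm. 5.1 and Cor. 5.2 (p. 21)] -/
theorem SupremacyTheoremsNonRelativizing.of_parts' (h₁ : BPPRel_ofLanguage_subset_BQPRel)
    (h₂ : BQPRel_subset_AWPPRel)
    (h₃ : ∃ A : Language Bool, PRel (Oracle.ofLanguage A) = AWPPRel (Oracle.ofLanguage A) ∧
      IsInfinitePHRel (Oracle.ofLanguage A))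
    (h₄ : fortnowRogers1999_thm42_core) (h₅ : aaronsonChen2017_thm51_samp)
    (h₆ : aaronsonChen2017_thm51_ph) : SupremacyTheoremsNonRelativizing :=
  ⟨fortnowRogers1999_cor37_of_parts h₁ h₂ h₃, fortnowRogers1999_thm42_of_parts h₄ h₁,
    aaronsonChen2017_cor52_of_thm51 h₅ h₆⟩

/-! ### The no-go theorems with `P^O ⊆ BPP^O` discharged -/

/-- The barrier's three no-go theorems for the canonical presentations, with no hypothesis left
besides the barrier fact (the statement file's `summary_canonical` fed with
`PRel_subset_BPPRel_holds`). [cite: FortnowRogers1999JCSS, Cor. 3.7, Thm. 4.2 (arXiv numbering)] [cite: AaronsonChen2017, Cor. 5.2 and §1 p. 8] -/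
theorem SupremacyTheoremsNonRelativizing.summary_canonical' (h : SupremacyTheoremsNonRelativizing) :
    (¬ Relativizes fun O => bqpRelOf O ⊆ BPPRel O → ¬ IsInfinitePHRel O) ∧
      (¬ Relativizes fun O => sampBQPRelOf O ⊆ SampPRel O → ¬ IsInfinitePHRel O) ∧
        ¬ Relativizes fun O => PRel O ≠ UPRel O ∩ coUPRel O → ¬ bqpRelOf O ⊆ BPPRel O :=
  h.summary_canonical PRel_subset_BPPRel_holds

/-- Template (a) hypothesis-free in `P^O ⊆ BPP^O`: `O ↦ (BQP^O ⊆ BPP^O → PH^O collapses)` does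
not relativize, for every presentation of `BQP^·`. [cite: FortnowRogers1999JCSS, Cor. 3.7 (arXiv numbering)] -/
theorem fortnowRogers1999_cor37.not_relativizes_collapse_template (h : fortnowRogers1999_cor37)
    {C : Oracle → Set (Language Bool)} (hC : PresentsBQPRel C) :
    ¬ Relativizes fun O => C O ⊆ BPPRel O → ¬ IsInfinitePHRel O :=
  QuantumAdvantage.not_relativizes_collapse_template h PRel_subset_BPPRel_holds hC

/-- `UP^∅ = UP`, hypothesis-free (`PRel_empty_holds`). [folklore] -/
theorem UPRel_empty' : UPRel Oracle.empty = UP :=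
  UPRel_empty PRel_empty_holds

/-- `coUP^∅ = coUP`, hypothesis-free. [folklore] -/
theorem coUPRel_empty' : coUPRel Oracle.empty = coUP :=
  coUPRel_empty PRel_empty_holds

/-! ### Discharge of `fortnowRogers1999_thm42_core` (rev. 3)

The oracle is `C = K ⊕ G` (`BrainProtocol.joinLang`, the same set as `oracleJoin K G`) with
`K = FRBrain.oracleK` the self-encoding brain oracle of
`Literature/Computability/QuantumComplexity/FortnowRogersBrain.lean` (`BQP^{K ⊕ G} ⊆ P^{K ⊕ G}` for
every `G` with at most one string per length, by the many-strings BBBV bound and the oracle-driven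
protocol machine of `Literature/Computability/Complexity/BrainProtocol.lean`) and `G` the diagonal
one-string-per-positive-length oracle of `Literature/Computability/Complexity/UPDiagonalOracle.lean`
(`testLang G ∉ P^{K ⊕ G}`, while its `1`- and `0`-witness verifiers are single-query `P^{K ⊕ G}`
languages with unique witnesses). With the core discharged, `fortnowRogers1999_thm42` itself follows
from the one machine fact `uniformOracleCoinSimulation` (`fortnowRogers1999_thm42_of_sim`). -/

section Thm42Core

open Literature.Computability.Complexity.BrainProtocol Literature.Computability.Complexity.UPDiag

/-- The join of `BrainProtocol.lean` is the barrier file's `oracleJoin` (same definition). [folklore] -/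
theorem joinLang_eq_oracleJoin (K G : Set (List Bool)) : joinLang K G = oracleJoin K G := rfl

/-- **`testLang G ∈ UP^{K ⊕ G}`** when `G` has exactly one string of every positive length: the
witness of `x` is the `w`, `|w| = |x|`, with `1w ∈ G`, verified by the one-query `P^{K ⊕ G}` language
`vLang true (K ⊕ G)`. [cite: FortnowRogers1999JCSS, proof of Thm. 4.2 (p. 7: "L^G ∈ UP^G ∩ coUP^G") (arXiv numbering)] -/
theorem testLang_mem_UPRel (K G : Set (List Bool)) (hG : ∀ n, 0 < n → ∃! z, z ∈ G ∧ z.length = n) :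
    testLang G ∈ UPRel (Oracle.ofLanguage (joinLang K G)) := by
  refine ⟨vLang true (joinLang K G), vLang_mem_PRel true _, Polynomial.X, fun x => ?_, fun x => ?_⟩
  · rw [Polynomial.eval_X]
    constructor
    · rintro ⟨w, hw, hwG⟩
      exact ⟨w, hw.le, boolPair_mem_vLang_joinLang.2 ⟨hw, hwG⟩⟩
    · rintro ⟨w, -, hw⟩
      obtain ⟨hw, hwG⟩ := boolPair_mem_vLang_joinLang.1 hw
      exact ⟨w, hw, hwG⟩
  · intro w hw w' hw'
    rw [Polynomial.eval_X] at hw hw'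
    exact (existsUnique_witness hG x).1 true (boolPair_mem_vLang_joinLang.1 hw.2) (boolPair_mem_vLang_joinLang.1 hw'.2)

/-- **`testLang G ∈ coUP^{K ⊕ G}`**: the complement has the unique witnesses `w` with `0w ∈ G`.
[cite: FortnowRogers1999JCSS, proof of Thm. 4.2 (p. 7) (arXiv numbering)] -/
theorem testLang_mem_coUPRel (K G : Set (List Bool)) (hG : ∀ n, 0 < n → ∃! z, z ∈ G ∧ z.length = n) :
    testLang G ∈ coUPRel (Oracle.ofLanguage (joinLang K G)) := by
  change (testLang G)ᶜ ∈ UPRel (Oracle.ofLanguage (joinLang K G))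
  refine ⟨vLang false (joinLang K G), vLang_mem_PRel false _, Polynomial.X, fun x => ?_, fun x => ?_⟩
  · rw [Polynomial.eval_X]
    change x ∉ testLang G ↔ _
    rw [(existsUnique_witness hG x).2, not_not]
    constructor
    · rintro ⟨w, hw, hwG⟩
      exact ⟨w, hw.le, boolPair_mem_vLang_joinLang.2 ⟨hw, hwG⟩⟩
    · rintro ⟨w, -, hw⟩
      obtain ⟨hw, hwG⟩ := boolPair_mem_vLang_joinLang.1 hw
      exact ⟨w, hw, hwG⟩
  · intro w hw w' hw'
    rw [Polynomial.eval_X] at hw hw'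
    exact (existsUnique_witness hG x).1 false (boolPair_mem_vLang_joinLang.1 hw.2) (boolPair_mem_vLang_joinLang.1 hw'.2)

/-- **Discharge of `fortnowRogers1999_thm42_core`** (Fortnow–Rogers 1999, the two claims of the
proof of Thm. 4.2): there is `C ⊆ {0,1}*` with `BQP^C ⊆ P^C` and `P^C ≠ UP^C ∩ coUP^C`, namely
`C = K ⊕ G` for the brain oracle `K` and the diagonal oracle `G` built against `K`.
[cite: FortnowRogers1999JCSS, Thm. 4.2 and its proof, p. 7 (arXiv numbering)] -/
theorem fortnowRogers1999_thm42_core_holds : fortnowRogers1999_thm42_core := by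
  obtain ⟨G, hG, hG0, hL⟩ := exists_oracleG Literature.Computability.QuantumComplexity.FRBrain.oracleK
  refine ⟨joinLang Literature.Computability.QuantumComplexity.FRBrain.oracleK G,
    Literature.Computability.QuantumComplexity.FRBrain.BQPRel_joinLang_oracleK_subset_PRel G ?_, fun heq => ?_⟩
  · -- at most one string per length
    intro ℓ z hz z' hz'
    rcases Nat.eq_zero_or_pos ℓ with rfl | hℓ
    · exact absurd (List.eq_nil_of_length_eq_zero hz.2 ▸ hz.1) hG0
    · obtain ⟨z₀, -, huniq⟩ := hG ℓ hℓ
      exact (huniq z hz).trans (huniq z' hz').symm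
  · exact hL (heq.symm ▸ ⟨testLang_mem_UPRel _ G hG, testLang_mem_coUPRel _ G hG⟩)

/-- **Fortnow–Rogers Thm. 4.2 from the remaining leaf** `BPP^A ⊆ BQP^A` (relativized
Bernstein–Vazirani Thm. 8.3, the tree fact `BPPRel_ofLanguage_subset_BQPRel`): with the core
discharged, `P^C = BPP^C = BQP^C ≠ UP^C ∩ coUP^C` is `fortnowRogers1999_thm42_of_parts`.
[cite: FortnowRogers1999JCSS, Thm. 4.2 (arXiv numbering)] -/
theorem fortnowRogers1999_thm42_of_BPPRel_subset_BQPRel (h : BPPRel_ofLanguage_subset_BQPRel) :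
    fortnowRogers1999_thm42 :=
  fortnowRogers1999_thm42_of_parts fortnowRogers1999_thm42_core_holds h

/-- **Fortnow–Rogers Thm. 4.2 from the single remaining machine fact** `uniformOracleCoinSimulation`
(`CoinFamilyKernel.lean`: the uniform reversible simulation, with oracle gates, of `FP^A` functions
of `⟨x, coins⟩`; it gives `BPP^A ⊆ BQP^A` by `BPPRel_ofLanguage_subset_BQPRel_of_sim`,
`BPPRelSubsetBQPRel.lean`). This is the whole trust base of `fortnowRogers1999_thm42` now.
[cite: FortnowRogers1999JCSS, Thm. 4.2 (arXiv numbering)] [cite: BernsteinVazirani1997SICOMP, Thm. 8.3 (proof) and §8.3] -/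
theorem fortnowRogers1999_thm42_of_sim (hsim : uniformOracleCoinSimulation) : fortnowRogers1999_thm42 :=
  fortnowRogers1999_thm42_of_BPPRel_subset_BQPRel (BPPRel_ofLanguage_subset_BQPRel_of_sim hsim)

/-- Thm. 4.1 as printed (one-way functions, i.e. `P^C ≠ UP^C`, together with `P^C = BQP^C`) from
the same leaf. [cite: FortnowRogers1999JCSS, Thm. 4.1 (arXiv numbering)] -/
theorem fortnowRogers1999_thm41_of_BPPRel_subset_BQPRel (h : BPPRel_ofLanguage_subset_BQPRel) :
    ∃ C : Language Bool, PRel (Oracle.ofLanguage C) ≠ UPRel (Oracle.ofLanguage C) ∧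
      PRel (Oracle.ofLanguage C) = BQPRel C :=
  (fortnowRogers1999_thm42_of_BPPRel_subset_BQPRel h).thm41

/-- The unconditional half of Thm. 4.1 available now: an oracle relative to which one-way
functions exist (`P^C ≠ UP^C`) and `BQP^C ⊆ P^C`. [cite: FortnowRogers1999JCSS, Thm. 4.1 and Thm. 4.2 (arXiv numbering)] -/
theorem exists_oracle_PRel_ne_UPRel_and_BQPRel_subset_PRel :
    ∃ C : Language Bool, PRel (Oracle.ofLanguage C) ≠ UPRel (Oracle.ofLanguage C) ∧
      BQPRel C ⊆ PRel (Oracle.ofLanguage C) := by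
  obtain ⟨C, hBQP, hUP⟩ := fortnowRogers1999_thm42_core_holds
  exact ⟨C, fun hPU => hUP (UPRel_inter_coUPRel_eq_of_eq hPU.symm).symm, hBQP⟩

/-- `SupremacyTheoremsNonRelativizing` from the FIVE remaining leaf facts and the oracle-existence
hypothesis `h₃` of Cor. 3.7 (the core of Thm. 4.2 being discharged). [cite: FortnowRogers1999JCSS, Cor. 3.7 and Thm. 4.2 (arXiv numbering)] [cite: AaronsonChen2017, Cor. 5.2 (p. 21)] -/
theorem SupremacyTheoremsNonRelativizing.of_parts₆ (h₁ : BPPRel_ofLanguage_subset_BQPRel)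
    (h₂ : BQPRel_subset_AWPPRel)
    (h₃ : ∃ A : Language Bool, PRel (Oracle.ofLanguage A) = AWPPRel (Oracle.ofLanguage A) ∧
      IsInfinitePHRel (Oracle.ofLanguage A))
    (h₅ : aaronsonChen2017_thm51_sampBQP_subset) (h₆ : SampPRel_subset_SampBQPRel)
    (h₇ : aaronsonChen2017_thm51_ph) : SupremacyTheoremsNonRelativizing :=
  SupremacyTheoremsNonRelativizing.of_parts h₁ h₂ h₃ fortnowRogers1999_thm42_core_holds h₅ h₆ h₇

end Thm42Core

end Literature.Barriers.QuantumAdvantage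

end
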